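import Summits.ResolutionOfSingularities.ResolutionOfSingularities.Theses.FrobeniusLadder
import Summits.ResolutionOfSingularities.ResolutionOfSingularities.Theorems.FrobeniusLadderFRationalResolutionStubTransport
import Summits.ResolutionOfSingularities.ResolutionOfSingularities.Theorems.FrobeniusLadderFRationalResolutionStubClauseOfRingEquiv
import Summits.ResolutionOfSingularities.ResolutionOfSingularities.Theorems.FrobeniusLadderFRationalResolutionStubComponents
import Mathlib.AlgebraicGeometry.Noetherian
import HarnessLib

/-!
# Crux `FRationalResolution` (stmt-ResolutionOfSingularities-15317) is equivalent to its integral form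

Route `FrobeniusLadder`, rank-4 crux `FRationalResolution` ("resolution of F-rational varieties",
transport-closed form): for every prime `p`, field `k` of characteristic `p` and reduced separated
finite-type `X/k`, an F-rational locally-integral proper birational model `X' → X` gives a resolution of
`X`. The route header records "Equivalent to 'every integral F-rational variety has a resolution' modulo
folklore (Literature `Scheme.HasResolution.of_isBirational`; clopen integral components)". This file
PROVES that equivalence (`fRationalResolution_iff_integral`), assembling the three landed glue stubs of
the line `Sketch` (`Cruxes/FRationalResolution/Lines/Sketch.lean`):

* `Transport.stub_transport` — the crux for `X` follows from resolving the model `X'` itself;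
* `Components.stub_components` — a finite-type `k`-scheme with integral stalks is resolved as soon as its
  integral open subschemes are (its irreducible components are clopen);
* `ClauseInvariance.stub_clause_of_ringEquiv` — the inline F-rational stalk clause transports along ring
  isomorphisms (here: the stalk isomorphisms of an open immersion).

So the crux is LITERALLY resolution of singularities for integral separated finite-type `k`-schemes all
of whose local rings are F-rational (every ideal generated by a system of parameters tightly closed) —
the summit restricted to the F-rational class, with no transport or component bookkeeping left in it.
-/

-- single-problem summit: the doubled namespace component `ResolutionOfSingularities` is forced
set_option linter.dupNamespace false

noncomputable section

open CategoryTheory AlgebraicGeometry TopologicalSpace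
open Literature.AlgebraicGeometry.Resolution

namespace Summit.ResolutionOfSingularities.ResolutionOfSingularities.Theorems.FRationalResolution

/-- **The locally integral form reduces to the integral form.** If every INTEGRAL separated finite-type
`k`-scheme whose stalks satisfy the F-rational clause (for the exponent base `p`) has a resolution, then
so does every separated finite-type `k`-scheme all of whose stalks are domains satisfying the clause:
resolve the (clopen, integral) irreducible components (`stub_components`), the clause passing to an open
subscheme along the stalk isomorphisms `𝒪_{X, j u} ≅ 𝒪_{U, u}` (`stub_clause_of_ringEquiv`). -/
theorem hasResolution_of_integralForm (p : ℕ) (k : Type) [Field k]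
    (hint : ∀ (X : Scheme.{0}) (f : X ⟶ Spec (.of k)), IsSeparated f → LocallyOfFiniteType f →
      QuasiCompact f → IsIntegral X →
      (∀ x : X, IsDomain (X.presheaf.stalk x) ∧ ∀ d : ℕ, ringKrullDim (X.presheaf.stalk x) = d →
        ∀ s : Fin d → X.presheaf.stalk x, (Ideal.span (Set.range s)).radical.IsMaximal →
        ∀ y c : X.presheaf.stalk x, c ≠ 0 →
        (∀ e : ℕ, c * y ^ p ^ e ∈ Ideal.span ((fun z : X.presheaf.stalk x => z ^ p ^ e) ''
          (Ideal.span (Set.range s) : Set (X.presheaf.stalk x)))) → y ∈ Ideal.span (Set.range s)) →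
      Scheme.HasResolution X)
    (X : Scheme.{0}) (f : X ⟶ Spec (.of k)) [IsSeparated f] [LocallyOfFiniteType f] [QuasiCompact f]
    (hFR : ∀ x : X, IsDomain (X.presheaf.stalk x) ∧ ∀ d : ℕ, ringKrullDim (X.presheaf.stalk x) = d →
      ∀ s : Fin d → X.presheaf.stalk x, (Ideal.span (Set.range s)).radical.IsMaximal →
      ∀ y c : X.presheaf.stalk x, c ≠ 0 →
      (∀ e : ℕ, c * y ^ p ^ e ∈ Ideal.span ((fun z : X.presheaf.stalk x => z ^ p ^ e) ''
        (Ideal.span (Set.range s) : Set (X.presheaf.stalk x)))) → y ∈ Ideal.span (Set.range s)) :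
    Scheme.HasResolution X := by
  refine Components.stub_components k X f (fun x => (hFR x).1) fun U j hj hU => ?_
  haveI := hj
  haveI := hU
  haveI : IsLocallyNoetherian X := LocallyOfFiniteType.isLocallyNoetherian f
  haveI : CompactSpace X := QuasiCompact.compactSpace_of_compactSpace f
  haveI : IsNoetherian X := { }
  haveI : NoetherianSpace U := j.isOpenEmbedding.isInducing.noetherianSpace
  exact hint U (j ≫ f) inferInstance inferInstance inferInstance hU fun u =>
    ClauseInvariance.stub_clause_of_ringEquiv p (asIso (j.stalkMap u)).commRingCatIsoToRingEquiv
      (hFR (j.base u))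

/-- **Crux `FRationalResolution` ↔ its integral form.** The rank-4 crux of route `FrobeniusLadder`
(an F-rational locally-integral proper birational model of a reduced separated finite-type `X/k` gives a
resolution of `X`, for every prime `p` and every field `k` of characteristic `p`) is EQUIVALENT to: for
every prime `p`, field `k` of characteristic `p` and INTEGRAL separated `k`-scheme `X` of finite type
whose local rings are F-rational (inline clause: every stalk a domain in which every ideal generated by a
system of parameters is tightly closed), `X` has a resolution of singularities. Forward: an integral
F-rational `X` is its own model along `𝟙 X` (birational over `⊤`). Backward: transport along the proper
birational model (`stub_transport`) and `hasResolution_of_integralForm`. -/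
theorem fRationalResolution_iff_integral :
    Summit.ResolutionOfSingularities.ResolutionOfSingularities.Theses.FrobeniusLadder.FRationalResolution ↔
      ∀ p : ℕ, p.Prime → ∀ (k : Type) [Field k] [CharP k p] (X : Scheme.{0})
        (f : X ⟶ Spec (.of k)), IsSeparated f → LocallyOfFiniteType f → QuasiCompact f →
        IsIntegral X →
        (∀ x : X, IsDomain (X.presheaf.stalk x) ∧ ∀ d : ℕ, ringKrullDim (X.presheaf.stalk x) = d →
          ∀ s : Fin d → X.presheaf.stalk x, (Ideal.span (Set.range s)).radical.IsMaximal →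
          ∀ y c : X.presheaf.stalk x, c ≠ 0 →
          (∀ e : ℕ, c * y ^ p ^ e ∈ Ideal.span ((fun z : X.presheaf.stalk x => z ^ p ^ e) ''
            (Ideal.span (Set.range s) : Set (X.presheaf.stalk x)))) →
            y ∈ Ideal.span (Set.range s)) →
        Scheme.HasResolution X := by
  unfold Summit.ResolutionOfSingularities.ResolutionOfSingularities.Theses.FrobeniusLadder.FRationalResolution
  constructor
  · intro h p hp k _ _ X f hsep hft hqc hint hFR
    refine h p hp k X f hsep hft hqc inferInstance ⟨X, 𝟙 X, inferInstance, ⟨⊤, ?_, ?_, ?_⟩, hFR⟩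
    · simp
    · simp
    · infer_instance
  · intro hint p hp k _ _ X f hsep hft hqc _ hmodel
    haveI := hsep
    haveI := hft
    haveI := hqc
    refine Transport.stub_transport p k X f (fun X' g hs hl hq hFR => ?_) hmodel
    haveI := hs
    haveI := hl
    haveI := hq
    exact hasResolution_of_integralForm p k (fun Y h hs' hl' hq' hY hY' => hint p hp k Y h hs' hl' hq' hY hY')
      X' g hFR

end Summit.ResolutionOfSingularities.ResolutionOfSingularities.Theorems.FRationalResolution

end
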